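import Summits.QuantumFields.YangMills.Theorems.BalabanUVNodesN15NeumannCubeTailRow
import Summits.QuantumFields.YangMills.Theorems.BalabanUVNodesN15NeumannCubeNonlocalDefect
import Summits.QuantumFields.YangMills.Theorems.BalabanUVNodesN15TwoSpacingGluingAveragingDefect
import Summits.QuantumFields.YangMills.Theorems.BalabanUVNodesN15TwoGridEntry1Core
import HarnessLib

/-!
# Route «BalabanUVNodes» (K3⁸ `SpineGivenEndpointR13SepCoPHV`, stmt-QuantumFields-27366), node N15 = NE2, -a lane, PROGRAMME N file N-IIu: THE η-DEFECT OF THE TAIL ROW —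
# `𝔇((−M_{h′}N′_LM_{ψ′})∘G′(□ + c), (−M_hN_LM_ψ)∘G(□ + c)) ≤ 1_□(y)1_□(y′)·r_F·e^{−ρ|y−y′|_T}` with `r_F` EXPONENTIALLY SMALL IN THE MARGIN and linear in the fits of the partition
# function and of the bump's collar across King's pairing and in the two-grid letter of `N_L` (dag-n15-w3 g4's located row (r1): the `hDT` hypothesis of file 45
# `…CurvedGluingSmoothCutDressedGluedDefect` and of g5's gauged capstone, for this lane's images-extended Neumann cubes)

Cell `pub-ymgap`, seat `pub-ymgap-dag-n15-a` (KNIT-BY-NAME, g23; HUMAN RULING D-0062; chair R424 venue; `bears_on: R4∕N15`).  Filed `--kind proof --supports stmt-QuantumFields-27366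
--as helper` — COUNT-NEUTRAL.  Theorems only (0 `def`, 0 `sorry`).  Imports BY NAME N-IIt `…NeumannCubeTailRow` (`hasMaj_far_sandwich_out`, `hasMaj_tailSandwich`, `mulOp_chiCube_comp_mulOp`),
N-IIm `…NeumannCubeNonlocalDefect` (through it N-IIk `hasMaj_idef_chiCube_comp_neumannCubeG_of`, parts 39∕52 `hasMaj_gOp`, `hasMaj_entries110`, `hasMaj_twoGridDefect`, part 47
`hasMaj_landauRe`), dag-n15-c FILE 99 `…TwoSpacingGluingAveragingDefect` (`hasMaj_idef_nonlocal_family`: the two-grid letter of `N_L = aQ*Q − ∂Π∂*`), part 58 `…TwoGridEntry1Core`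
(`hasMaj_comp_pull_kingPrV`), FILE 59 `…TwoSpacingGluingCubes` (`idef_sandwich`, `idef_neg`), lit `idef_mulOp_eq`; nothing in the tree is modified.

WHY.  File 45's two-grid capstone (and n15-w3 g5's gauged edition) DISPLAYS, per cube, the η-defect row of the dressed cube's tail `hDT : 𝔇(T′_□, T_□) ≤ 1_S1_S·r_F e^{−ρ_T d}`,
`T_□ = (−M_hN_LM_{1−χ̃})∘N_□`, «producer dag-n15-a» (n15-w3 HANDOFF §g4 INPUT MAP).  N-IIt typed `hT ∕ hT′`; THIS FILE types `hDT` for the images-extended Neumann cubes: the exact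
three-term Leibniz split of the sandwich's defect (dag-n15-c FILE 59 `idef_sandwich` + lit `idef_mulOp_eq`: `𝔇(M_{h′}N′_LM_{ψ′}, M_hN_LM_ψ) = M_{h′}N′_LM_{ψ′−ψ∘π}P + M_{h′}𝔇(N′_L, N_L)M_ψ
+ M_{h′−h∘π}PN_LM_ψ`), each term a far sandwich (N-IIt §1) — so the defect letter `r₁ = (c_N o_ψ + r_N + o_h c_N)·e^{−(δ_N−ρ₁)gap}` is exponentially small in the margin AND linear in the
fits `o_h = sup|h′ − h∘π|`, `o_ψ = sup|ψ′ − ψ∘π|` and in the two-grid letter `r_N` of `N_L` (§1) — then N-IIk's cube-behind-an-operator defect row (§2) and the lineage's letters discharged (§3).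

WHAT.
* §0 `idef_neg_cutTail_eq` (generic: the tail's defect = minus the cut cube's defect when `M_χM_h = M_h`);
* §1 ★★ `hasMaj_idef_tailSandwich` (`𝔇(M_{h′}N′_LM_{ψ′}, M_hN_LM_ψ) ≤ (c_N o_ψ + r_N + o_h c_N)e^{−(δ_N−ρ₁)gap}·e^{−ρ₁d}`; letters `∂Π∂* ≤ C₁e^{−δ₁d}` (fine), `𝔇(N′_L, N_L) ≤ r_Ne^{−δ_Nd}`
  displayed; supports∕plateaus∕fits∕gap as hypotheses);
* §2 ★★★ `hasMaj_idef_tail_neumannCubeG_of` (doubled-cube torus `M_ν = 2S`, coarse `n = L^k`, fine `n′ = L^r·n`: N-IIk `_of` at the sandwich pair — `𝔇(T′_□, T_□) ≤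
  1_□1_□·2^{d+1}e^{δ₀}c_r·(a₁C₀ + a₁(d+1)C_∇∕L^k + r₁C)·e^{−ρd}`, `a₁ = c_N e^{−(δ_N−ρ₁)gap}`, `r₁` as in §1; the torus letters `G, 𝔇(G′,G), ∇G` and `∂Π∂*`, `𝔇(N′_L,N_L)` displayed);
* §3 ★★★ `hasMaj_idef_tail_neumannCubeG` (the lineage's doubled tori `MP (paramsOf d L m_T k hL)`, cube side `S` with `M_ν = 2S` in any spelling, `k ≥ 1`, `r`, `0 < γ < 1`: EVERY analytic
  letter DISCHARGED — (1.110) entries via `hasMaj_gOp`∕`hasMaj_entries110`, King's rate via `hasMaj_twoGridDefect`, (1.126) via `hasMaj_landauRe`, FILE 99 `hasMaj_idef_nonlocal_family` —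
  `∃ δ_T δ_g c_T > 0`: `𝔇(T′_□, T_□) ≤ 1_□1_□·c_T·(o_h + o_ψ + (L^k)^{−γ∕2})·e^{−δ_g·gap}·e^{−δ_T d}`; `h, ψ, h′, ψ′, H, A, gap, o_h, o_ψ` generic = dag-n15-c's partition (FILE 67, fit
  `π(d+1)∕(nw)`) and bump instance (r2) plug in unchanged).

HONEST FRAMING ∕ LIMITS.  Block-majorant bookkeeping over LANDED letters + finite-dimensional operator algebra; no new analytic estimate; `U ≡ 1` doubled-cube torus MODEL (one-cube
model; ref-B OBSERVATION-2 ∕ CAUTION-P (4)); [B5] (1.69) p.29, (1.120)–(1.123) p.37, (1.126) p.38 ∕ [B6] (2.36)–(2.37) p.229, (2.92)–(2.93) p.239, (2.133)–(2.134) p.247 ∕ [B9] Thm 3.14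
pp.426–427 (difference TEMPLATE), (3.63)–(3.65) pp.402–403 = SHAPES ∕ MECHANISM, nothing of [B5]∕[B6]∕[B9] asserted; NE2⁺ NOT PRINTED ∕ NOT proved; N15 NOT discharged; K3⁸ OPEN,
skeleton v6 untouched; counts of record UNMOVED (typed 28∕28 · discharged 5∕27); one finite 𝕋⁴ at fixed ε — NOT infinite volume, NOT OS on ℝ⁴, NOT a mass gap, NOT Clay; R4 closes
the conditional finite-𝕋⁴ rung `BalabanLadder.UV` only.  Restate-immune (no Theses import).
-/

noncomputable section

open scoped BigOperators
open Finset

namespace Summit.QuantumFields.YangMills.BalabanUVNodes.N15.TwoGrid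

open Literature.MathematicalPhysics.QuantumFieldTheory.Balaban1983to89
open Literature.MathematicalPhysics.QuantumFieldTheory.Balaban1983to89.B5Prop11Plancherel (Tor fine)
open Literature.MathematicalPhysics.QuantumFieldTheory.Balaban1983to89.B6Prop26Gluing (mulOp mulOp_apply ind ind_nonneg ind_le_one)
open Literature.MathematicalPhysics.QuantumFieldTheory.King1986.Torus (blockOf tdistT tdistT_nonneg)
open Literature.MathematicalPhysics.QuantumFieldTheory.Balaban1983to89.B11SectG (BlockNorm HasMaj RowSum)
open Literature.MathematicalPhysics.QuantumFieldTheory.Balaban1983to89.B6UnitTorusCarrier (unitTorusGeo triangle254_unitTorusGeo rowSum_unitTorusGeo)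
open Literature.MathematicalPhysics.QuantumFieldTheory.Balaban1983to89.B6RandomWalk (Triangle254)
open Literature.MathematicalPhysics.QuantumFieldTheory.Balaban1983to89.T4EtaRateDefect (idef idef_apply idef_comp)
open Literature.MathematicalPhysics.QuantumFieldTheory.Balaban1983to89.T4EtaRateCoeffDefect (pull pull_apply diagK diagK_nonneg hasMaj_mulOp idef_mulOp_eq)
open Literature.MathematicalPhysics.QuantumFieldTheory.Balaban1983to89.B5SiteBridgeP12 (MP)
open Summit.QuantumFields.YangMills.BalabanUVNodes.N15.VectorPiece (blkFine kingPrV blkFine_comp_kingPrV)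
open Summit.QuantumFields.YangMills.BalabanUVNodes.N15.Gluing (hasMaj_diag_comp hasMaj_comp_diag hasMaj_nonlocalPart hasMaj_idef_nonlocal_family idef_sandwich)

variable {d : ℕ}

/-! ## §0 Algebra: the tail's defect with the cube's cut behind the partition functions -/

section Algebra

variable {X X' : Type} (π : X' → X)

/-- ★ reading the cut cube's defect as the tail's: if `M_χ∘M_h = M_h` and `M_{χ′}∘M_{h′} = M_{h′}` then
`𝔇((−M_{h′}R′)∘B′, (−M_hR)∘B) = −𝔇(M_{χ′}∘(M_{h′}R′)∘B′, M_χ∘(M_hR)∘B)` (generic carriers — on the lineage's `MP (paramsOf …)` tori use it through `HasMaj.congr`, never by `rw`). [folklore] -/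
theorem idef_neg_cutTail_eq {χ h : X → ℝ} {χ' h' : X' → ℝ} (R B : Module.End ℝ (X → ℝ)) (R' B' : Module.End ℝ (X' → ℝ))
    (hc : mulOp χ ∘ₗ mulOp h = mulOp h) (hc' : mulOp χ' ∘ₗ mulOp h' = mulOp h') :
    idef (pull π) (pull π) ((-(mulOp h' ∘ₗ R')) ∘ₗ B') ((-(mulOp h ∘ₗ R)) ∘ₗ B) =
      -idef (pull π) (pull π) (mulOp χ' ∘ₗ (mulOp h' ∘ₗ R') ∘ₗ B') (mulOp χ ∘ₗ (mulOp h ∘ₗ R) ∘ₗ B) := by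
  have h1 : ∀ v, mulOp χ (mulOp h v) = mulOp h v := fun v => by simpa only [LinearMap.comp_apply] using LinearMap.congr_fun hc v
  have h2 : ∀ v, mulOp χ' (mulOp h' v) = mulOp h' v := fun v => by simpa only [LinearMap.comp_apply] using LinearMap.congr_fun hc' v
  refine LinearMap.ext fun f => ?_
  simp only [idef_apply, LinearMap.neg_apply, LinearMap.comp_apply, h1, h2, map_neg]
  abel

end Algebra

/-! ## §1 The sandwich's η-defect: exponentially small in the margin, linear in the fits and in `N_L`'s two-grid letter -/

section Sandwich

variable {L : ℕ} [NeZero L] {M : Fin (d + 1) → ℕ} [∀ μ, NeZero (M μ)] {k r : ℕ}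

/-- ★★ **THE η-DEFECT OF THE TAIL's SANDWICH**: coarse spacing `n = L^k`, fine `n′ = L^r·n`, King's pairing `π`; the fine letter `∂Π∂*′ ≤ C₁e^{−δ₁d}`, `0 ≤ δ_N ≤ δ₁`, the two-grid
letter `𝔇(N′_L, N_L) ≤ r_N e^{−δ_Nd}` of `N_L = aQ*Q − ∂Π∂*`, `ρ₁ ≤ δ_N`; partition functions `|h|, |h′| ≤ 1` vanishing off the blocks of `H`, collars `|ψ|, |ψ′| ≤ 1` vanishing on the
blocks of `A`, fits `|h′ − h∘π| ≤ o_h`, `|ψ′ − ψ∘π| ≤ o_ψ`, `|y − y′|_T ≥ gap` for `y ∈ H`, `y′ ∉ A` ⟹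
`𝔇(M_{h′}N′_LM_{ψ′}, M_hN_LM_ψ) ≤ (c_N o_ψ + r_N + o_h c_N)·e^{−(δ_N−ρ₁)gap}·e^{−ρ₁|y−y′|_T}`, `c_N = |a|e^{2δ_N} + C₁`.
[cite: Balaban1985BackgroundPropagators, Thm 3.14 pp.426–427 (difference template); Balaban1984PropagatorsI, (1.69) p.29, (1.120)–(1.123) p.37, (1.126) p.38; Balaban1984PropagatorsII, (2.92)–(2.93) p.239 (mechanism)] -/
theorem hasMaj_idef_tailSandwich {a C₁ δ₁ δN ρ₁ rN gap oh oψ : ℝ} (hC₁ : 0 ≤ C₁) (hδN : 0 ≤ δN) (hδ : δN ≤ δ₁) (hρ₁ : ρ₁ ≤ δN) (hrN : 0 ≤ rN) (hoh : 0 ≤ oh) (hoψ : 0 ≤ oψ)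
    (hNL : HasMaj (BlockNorm.ofBlocks (unitTorusGeo L k M) (fun b : Tor (fine (L ^ k) M) × Fin (d + 1) => blockOf (L ^ k) M b.1))
      (BlockNorm.ofBlocks (unitTorusGeo L k M) (fun b : Tor (fine (L ^ k) M) × Fin (d + 1) => blockOf (L ^ k) M b.1)) (landauRe M (L ^ k))
      (fun y y' => C₁ * Real.exp (-(δ₁ * tdistT M y y'))))
    (hNL' : HasMaj (BlockNorm.ofBlocks (unitTorusGeo L k M) (fun b : Tor (fine (L ^ r * L ^ k) M) × Fin (d + 1) => blockOf (L ^ r * L ^ k) M b.1))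
      (BlockNorm.ofBlocks (unitTorusGeo L k M) (fun b : Tor (fine (L ^ r * L ^ k) M) × Fin (d + 1) => blockOf (L ^ r * L ^ k) M b.1)) (landauRe M (L ^ r * L ^ k))
      (fun y y' => C₁ * Real.exp (-(δ₁ * tdistT M y y'))))
    (hDN : HasMaj (BlockNorm.ofBlocks (unitTorusGeo L k M) (fun b : Tor (fine (L ^ k) M) × Fin (d + 1) => blockOf (L ^ k) M b.1))
      (BlockNorm.ofBlocks (unitTorusGeo L k M) (fun b : Tor (fine (L ^ r * L ^ k) M) × Fin (d + 1) => blockOf (L ^ r * L ^ k) M b.1))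
      (idef (pull (kingPrV L k r M)) (pull (kingPrV L k r M)) (a • (qvAdjRe M (L ^ r * L ^ k) ∘ₗ qvRe M (L ^ r * L ^ k)) + (-landauRe M (L ^ r * L ^ k)))
        (a • (qvAdjRe M (L ^ k) ∘ₗ qvRe M (L ^ k)) + (-landauRe M (L ^ k)))) (fun y y' => rN * Real.exp (-(δN * tdistT M y y'))))
    {h ψ : Tor (fine (L ^ k) M) × Fin (d + 1) → ℝ} {h' ψ' : Tor (fine (L ^ r * L ^ k) M) × Fin (d + 1) → ℝ} {H A : Set (Tor M)}
    (hhH : ∀ x, blockOf (L ^ k) M x.1 ∉ H → h x = 0) (hψ1 : ∀ x, |ψ x| ≤ 1) (hψA : ∀ x, blockOf (L ^ k) M x.1 ∈ A → ψ x = 0)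
    (hh1' : ∀ x', |h' x'| ≤ 1) (hhH' : ∀ x', blockOf (L ^ r * L ^ k) M x'.1 ∉ H → h' x' = 0) (hψA' : ∀ x', blockOf (L ^ r * L ^ k) M x'.1 ∈ A → ψ' x' = 0)
    (hfh : ∀ x', |h' x' - h (kingPrV L k r M x')| ≤ oh) (hfψ : ∀ x', |ψ' x' - ψ (kingPrV L k r M x')| ≤ oψ)
    (hgap : ∀ y y', y ∈ H → y' ∉ A → gap ≤ tdistT M y y') :
    HasMaj (BlockNorm.ofBlocks (unitTorusGeo L k M) (fun b : Tor (fine (L ^ k) M) × Fin (d + 1) => blockOf (L ^ k) M b.1))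
      (BlockNorm.ofBlocks (unitTorusGeo L k M) (fun b : Tor (fine (L ^ r * L ^ k) M) × Fin (d + 1) => blockOf (L ^ r * L ^ k) M b.1))
      (idef (pull (kingPrV L k r M)) (pull (kingPrV L k r M)) (mulOp h' ∘ₗ (a • (qvAdjRe M (L ^ r * L ^ k) ∘ₗ qvRe M (L ^ r * L ^ k)) + (-landauRe M (L ^ r * L ^ k))) ∘ₗ mulOp ψ')
        (mulOp h ∘ₗ (a • (qvAdjRe M (L ^ k) ∘ₗ qvRe M (L ^ k)) + (-landauRe M (L ^ k))) ∘ₗ mulOp ψ))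
      (fun y y' => ((|a| * (Real.exp δN * Real.exp δN) + C₁) * oψ + rN + oh * (|a| * (Real.exp δN * Real.exp δN) + C₁)) * Real.exp (-((δN - ρ₁) * gap)) *
        Real.exp (-(ρ₁ * tdistT M y y'))) := by
  have hblk : ∀ x' : Tor (fine (L ^ r * L ^ k) M) × Fin (d + 1), blockOf (L ^ k) M (kingPrV L k r M x').1 = blockOf (L ^ r * L ^ k) M x'.1 := fun x' =>
    congrFun (blkFine_comp_kingPrV M L k r) x'
  have hcN : 0 ≤ |a| * (Real.exp δN * Real.exp δN) + C₁ := by positivity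
  -- the fine nonlocal letter
  have hN' := hasMaj_nonlocalPart (L := L) (kk := k) (a := a) hC₁ hδN hδ hNL'
  -- the fit functions: bounds and supports
  have heψ1 : ∀ x', |(ψ' - ψ ∘ kingPrV L k r M) x'| ≤ oψ := fun x' => by rw [Pi.sub_apply, Function.comp_apply]; exact hfψ x'
  have heψA : ∀ x', blockOf (L ^ r * L ^ k) M x'.1 ∈ A → (ψ' - ψ ∘ kingPrV L k r M) x' = 0 := fun x' hx' => by
    rw [Pi.sub_apply, Function.comp_apply, hψA' x' hx', hψA _ (by rw [hblk x']; exact hx'), sub_zero]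
  have heh1 : ∀ x', |(h' - h ∘ kingPrV L k r M) x'| ≤ oh := fun x' => by rw [Pi.sub_apply, Function.comp_apply]; exact hfh x'
  have hehH : ∀ x', blockOf (L ^ r * L ^ k) M x'.1 ∉ H → (h' - h ∘ kingPrV L k r M) x' = 0 := fun x' hx' => by
    rw [Pi.sub_apply, Function.comp_apply, hhH' x' hx', hhH _ (by rw [hblk x']; exact hx'), sub_zero]
  -- TERM 1: `M_{h′}∘N′∘M_{ψ′−ψ∘π}`, then `∘P`
  have t1 := hasMaj_far_sandwich_out (g := unitTorusGeo L k M) (fun b : Tor (fine (L ^ r * L ^ k) M) × Fin (d + 1) => blockOf (L ^ r * L ^ k) M b.1)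
    (fun b : Tor (fine (L ^ r * L ^ k) M) × Fin (d + 1) => blockOf (L ^ r * L ^ k) M b.1) hcN hρ₁ zero_le_one hoψ hh1' hhH' heψ1 heψA
    (fun y y' hy hy' => hgap y y' hy hy') hN'
  have t1P := hasMaj_comp_pull_kingPrV (L := L) (k := k) (m := r) (M := M) (fun y y' => mul_nonneg (ind_nonneg _ _) (by positivity)) t1
  -- TERM 2: `M_{h′}∘𝔇(N′, N)∘M_ψ`
  have t2 := hasMaj_far_sandwich_out (g := unitTorusGeo L k M) (fun b : Tor (fine (L ^ k) M) × Fin (d + 1) => blockOf (L ^ k) M b.1)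
    (fun b : Tor (fine (L ^ r * L ^ k) M) × Fin (d + 1) => blockOf (L ^ r * L ^ k) M b.1) hrN hρ₁ zero_le_one zero_le_one hh1' hhH' hψ1 hψA
    (fun y y' hy hy' => hgap y y' hy hy') hDN
  -- TERM 3: `M_{h′−h∘π}∘(P∘N)∘M_ψ`
  have hN := hasMaj_nonlocalPart (L := L) (kk := k) (a := a) hC₁ hδN hδ hNL
  have hPN := hasMaj_pull_comp₂ (g := unitTorusGeo L k M) (fun b : Tor (fine (L ^ k) M) × Fin (d + 1) => blockOf (L ^ k) M b.1)
    (fun b : Tor (fine (L ^ r * L ^ k) M) × Fin (d + 1) => blockOf (L ^ r * L ^ k) M b.1) (kingPrV L k r M)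
    (K' := fun y y' => (|a| * (Real.exp δN * Real.exp δN) + C₁) * Real.exp (-(δN * tdistT M y y')))
    (fun y y' => mul_nonneg hcN (Real.exp_nonneg _)) (fun x y' => by rw [hblk x]) hN
  have t3 := hasMaj_far_sandwich_out (g := unitTorusGeo L k M) (fun b : Tor (fine (L ^ k) M) × Fin (d + 1) => blockOf (L ^ k) M b.1)
    (fun b : Tor (fine (L ^ r * L ^ k) M) × Fin (d + 1) => blockOf (L ^ r * L ^ k) M b.1) hcN hρ₁ hoh zero_le_one heh1 hehH hψ1 hψA
    (fun y y' hy hy' => hgap y y' hy hy') hPN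
  -- sum (dag-n15-c FILE 59 `idef_sandwich` + the exact fit formula `𝔇(M_{a′}, M_a) = M_{a′−a∘π}∘P`)
  rw [idef_sandwich, idef_mulOp_eq, idef_mulOp_eq]
  refine (((t1P.congr fun f => rfl).add t2).add (t3.congr fun f => rfl)).mono fun y y' => ?_
  have hI : ind (g := unitTorusGeo L k M) H y ≤ 1 := ind_le_one _ _
  have hI0 : 0 ≤ ind (g := unitTorusGeo L k M) H y := ind_nonneg _ _
  have hE : 0 ≤ Real.exp (-((δN - ρ₁) * gap)) * Real.exp (-(ρ₁ * tdistT M y y')) := by positivity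
  have key : ind (g := unitTorusGeo L k M) H y *
        (((|a| * (Real.exp δN * Real.exp δN) + C₁) * oψ + rN + oh * (|a| * (Real.exp δN * Real.exp δN) + C₁)) *
          (Real.exp (-((δN - ρ₁) * gap)) * Real.exp (-(ρ₁ * tdistT M y y')))) ≤
      1 * (((|a| * (Real.exp δN * Real.exp δN) + C₁) * oψ + rN + oh * (|a| * (Real.exp δN * Real.exp δN) + C₁)) *
          (Real.exp (-((δN - ρ₁) * gap)) * Real.exp (-(ρ₁ * tdistT M y y')))) :=
    mul_le_mul_of_nonneg_right hI (by positivity)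
  calc ind (g := unitTorusGeo L k M) H y * (1 * (|a| * (Real.exp δN * Real.exp δN) + C₁) * oψ * Real.exp (-((δN - ρ₁) * gap)) * Real.exp (-(ρ₁ * tdistT M y y'))) +
          ind (g := unitTorusGeo L k M) H y * (1 * rN * 1 * Real.exp (-((δN - ρ₁) * gap)) * Real.exp (-(ρ₁ * tdistT M y y'))) +
        ind (g := unitTorusGeo L k M) H y * (oh * (|a| * (Real.exp δN * Real.exp δN) + C₁) * 1 * Real.exp (-((δN - ρ₁) * gap)) * Real.exp (-(ρ₁ * tdistT M y y')))
      = ind (g := unitTorusGeo L k M) H y *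
          (((|a| * (Real.exp δN * Real.exp δN) + C₁) * oψ + rN + oh * (|a| * (Real.exp δN * Real.exp δN) + C₁)) *
            (Real.exp (-((δN - ρ₁) * gap)) * Real.exp (-(ρ₁ * tdistT M y y')))) := by ring
    _ ≤ _ := key.trans_eq (by ring)

end Sandwich

/-! ## §2 The η-defect of the tail row of one Neumann cube (doubled-cube torus `M_ν = 2S`, coarse `L^k`, fine `L^r·L^k`) -/

section Cube

variable {L : ℕ} [NeZero L] {M : Fin (d + 1) → ℕ} [∀ μ, NeZero (M μ)] {k r : ℕ} {c : Tor M} {S : ℕ}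

/-- ★★★ **THE η-DEFECT OF THE TAIL ROW** (dag-n15-w3 file 45's `hDT`): on the doubled-cube torus `M_ν = 2S`, coarse spacing `L^k`, fine `L^r·L^k`, King's prolongation `P` on both sides,
from the torus letters `G ≤ Ce^{−δ₀d}`, `𝔇(G′, G) ≤ C₀e^{−δ₀d}`, `∇_νG ≤ C_∇e^{−δ₀d}` (Prop. 1.2 (1.110) + King's rate), the nonlocal letters `∂Π∂* ≤ C₁e^{−δ₁d}` (both spacings) and
`𝔇(N′_L, N_L) ≤ r_Ne^{−δ_Nd}`, a row sum `c_r` at rate `σ` (`0 ≤ ρ ≤ δ₀`, `ρ + σ ≤ ρ₁ ≤ δ_N ≤ δ₁`), partition functions `|h|, |h′| ≤ 1` on blocks `H ⊆ □`, collars `|ψ|, |ψ′| ≤ 1`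
vanishing on the plateau blocks `A`, fits `o_h, o_ψ` across the pairing and `|y − y′|_T ≥ gap` for `y ∈ H`, `y′ ∉ A`:
`𝔇((−M_{h′}N′_LM_{ψ′})∘G′(□ + c), (−M_hN_LM_ψ)∘G(□ + c)) ≤ 1_□(y)1_□(y′)·2^{d+1}e^{δ₀}c_r·(a₁C₀ + a₁(d+1)C_∇∕L^k + r₁C)·e^{−ρ|y−y′|_T}`,
`a₁ = c_N e^{−(δ_N−ρ₁)gap}`, `r₁ = (c_N o_ψ + r_N + o_h c_N)e^{−(δ_N−ρ₁)gap}`, `c_N = |a|e^{2δ_N} + C₁` — N-IIk `hasMaj_idef_chiCube_comp_neumannCubeG_of` at the sandwich pair.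
[cite: Balaban1985BackgroundPropagators, Thm 3.14 pp.426–427 (difference template), (3.63)–(3.65) pp.402–403 (mechanism); Balaban1984PropagatorsII, (2.36)–(2.37) p.229 (images), Lemma 2.1 (2.61)–(2.62) p.234, (2.92)–(2.93) p.239, (2.133)–(2.134) p.247 (shapes); Balaban1984PropagatorsI, (1.69) p.29, Prop. 1.2 (1.110) p.35, (1.120)–(1.123) p.37, (1.126)–(1.128) p.38; King1986, Prop. 3.9 (3.73) p.665 (η-rate shape)] -/
theorem hasMaj_idef_tail_neumannCubeG_of (hM : ∀ ν, M ν = 2 * S) {a : ℝ} (ha : 0 < a) {C C₀ CD δ₀ C₁ δ₁ δN rN ρ₁ ρ σ cr gap oh oψ : ℝ}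
    (htri : Triangle254 (unitTorusGeo L k M)) (hrow : RowSum (unitTorusGeo L k M) σ cr) (hC : 0 ≤ C) (hC₀ : 0 ≤ C₀) (hCD : 0 ≤ CD) (hδ₀ : 0 ≤ δ₀) (hC₁ : 0 ≤ C₁) (hδN : 0 ≤ δN)
    (hδN₁ : δN ≤ δ₁) (hrN : 0 ≤ rN) (hρ₁ : ρ₁ ≤ δN) (hρ : 0 ≤ ρ) (hρδ : ρ ≤ δ₀) (hρσ : ρ + σ ≤ ρ₁) (hoh : 0 ≤ oh) (hoψ : 0 ≤ oψ)
    (hG : HasMaj (BlockNorm.ofBlocks (unitTorusGeo L k M) (fun b : Tor (fine (L ^ k) M) × Fin (d + 1) => blockOf (L ^ k) M b.1))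
      (BlockNorm.ofBlocks (unitTorusGeo L k M) (fun b : Tor (fine (L ^ k) M) × Fin (d + 1) => blockOf (L ^ k) M b.1)) (gOp M (L ^ k) a)
      (fun y y' => C * Real.exp (-(δ₀ * tdistT M y y'))))
    (h0 : HasMaj (BlockNorm.ofBlocks (unitTorusGeo L k M) (fun b : Tor (fine (L ^ k) M) × Fin (d + 1) => blockOf (L ^ k) M b.1))
      (BlockNorm.ofBlocks (unitTorusGeo L k M) (fun b' : Tor (fine (L ^ r * L ^ k) M) × Fin (d + 1) => blockOf (L ^ r * L ^ k) M b'.1))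
      (idef (pull (kingPrV L k r M)) (pull (kingPrV L k r M)) (gOp M (L ^ r * L ^ k) a) (gOp M (L ^ k) a)) (fun y y' => C₀ * Real.exp (-(δ₀ * tdistT M y y'))))
    (h1 : ∀ ν, HasMaj (BlockNorm.ofBlocks (unitTorusGeo L k M) (fun b : Tor (fine (L ^ k) M) × Fin (d + 1) => blockOf (L ^ k) M b.1))
      (BlockNorm.ofBlocks (unitTorusGeo L k M) (fun b : Tor (fine (L ^ k) M) × Fin (d + 1) => blockOf (L ^ k) M b.1))
      (symbOp M (L ^ k) (sD M (L ^ k) ν ((L ^ k : ℕ) : ℝ)) ∘ₗ gOp M (L ^ k) a) (fun y y' => CD * Real.exp (-(δ₀ * tdistT M y y'))))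
    (hNL : HasMaj (BlockNorm.ofBlocks (unitTorusGeo L k M) (fun b : Tor (fine (L ^ k) M) × Fin (d + 1) => blockOf (L ^ k) M b.1))
      (BlockNorm.ofBlocks (unitTorusGeo L k M) (fun b : Tor (fine (L ^ k) M) × Fin (d + 1) => blockOf (L ^ k) M b.1)) (landauRe M (L ^ k))
      (fun y y' => C₁ * Real.exp (-(δ₁ * tdistT M y y'))))
    (hNL' : HasMaj (BlockNorm.ofBlocks (unitTorusGeo L k M) (fun b : Tor (fine (L ^ r * L ^ k) M) × Fin (d + 1) => blockOf (L ^ r * L ^ k) M b.1))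
      (BlockNorm.ofBlocks (unitTorusGeo L k M) (fun b : Tor (fine (L ^ r * L ^ k) M) × Fin (d + 1) => blockOf (L ^ r * L ^ k) M b.1)) (landauRe M (L ^ r * L ^ k))
      (fun y y' => C₁ * Real.exp (-(δ₁ * tdistT M y y'))))
    (hDN : HasMaj (BlockNorm.ofBlocks (unitTorusGeo L k M) (fun b : Tor (fine (L ^ k) M) × Fin (d + 1) => blockOf (L ^ k) M b.1))
      (BlockNorm.ofBlocks (unitTorusGeo L k M) (fun b : Tor (fine (L ^ r * L ^ k) M) × Fin (d + 1) => blockOf (L ^ r * L ^ k) M b.1))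
      (idef (pull (kingPrV L k r M)) (pull (kingPrV L k r M)) (a • (qvAdjRe M (L ^ r * L ^ k) ∘ₗ qvRe M (L ^ r * L ^ k)) + (-landauRe M (L ^ r * L ^ k)))
        (a • (qvAdjRe M (L ^ k) ∘ₗ qvRe M (L ^ k)) + (-landauRe M (L ^ k)))) (fun y y' => rN * Real.exp (-(δN * tdistT M y y'))))
    {h ψ : Tor (fine (L ^ k) M) × Fin (d + 1) → ℝ} {h' ψ' : Tor (fine (L ^ r * L ^ k) M) × Fin (d + 1) → ℝ} {H A : Set (Tor M)}
    (hhH : ∀ x, blockOf (L ^ k) M x.1 ∉ H → h x = 0) (hHc : ∀ y, y ∈ H → y ∈ cubeBlocks M c S)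
    (hψ1 : ∀ x, |ψ x| ≤ 1) (hψA : ∀ x, blockOf (L ^ k) M x.1 ∈ A → ψ x = 0)
    (hh1' : ∀ x', |h' x'| ≤ 1) (hhH' : ∀ x', blockOf (L ^ r * L ^ k) M x'.1 ∉ H → h' x' = 0)
    (hψ1' : ∀ x', |ψ' x'| ≤ 1) (hψA' : ∀ x', blockOf (L ^ r * L ^ k) M x'.1 ∈ A → ψ' x' = 0)
    (hfh : ∀ x', |h' x' - h (kingPrV L k r M x')| ≤ oh) (hfψ : ∀ x', |ψ' x' - ψ (kingPrV L k r M x')| ≤ oψ)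
    (hgap : ∀ y y', y ∈ H → y' ∉ A → gap ≤ tdistT M y y') :
    HasMaj (BlockNorm.ofBlocks (unitTorusGeo L k M) (fun b : Tor (fine (L ^ k) M) × Fin (d + 1) => blockOf (L ^ k) M b.1))
      (BlockNorm.ofBlocks (unitTorusGeo L k M) (fun b' : Tor (fine (L ^ r * L ^ k) M) × Fin (d + 1) => blockOf (L ^ r * L ^ k) M b'.1))
      (idef (pull (kingPrV L k r M)) (pull (kingPrV L k r M))
        ((-(mulOp h' ∘ₗ (a • (qvAdjRe M (L ^ r * L ^ k) ∘ₗ qvRe M (L ^ r * L ^ k)) + (-landauRe M (L ^ r * L ^ k))) ∘ₗ mulOp ψ')) ∘ₗ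
          neumannCubeG M (L ^ r * L ^ k) c S a)
        ((-(mulOp h ∘ₗ (a • (qvAdjRe M (L ^ k) ∘ₗ qvRe M (L ^ k)) + (-landauRe M (L ^ k))) ∘ₗ mulOp ψ)) ∘ₗ neumannCubeG M (L ^ k) c S a))
      (fun y y' => ind (cubeBlocks M c S : Set (Tor M)) y * ind (cubeBlocks M c S : Set (Tor M)) y' *
        ((2 ^ (d + 1) * Real.exp δ₀ * cr *
          ((|a| * (Real.exp δN * Real.exp δN) + C₁) * Real.exp (-((δN - ρ₁) * gap)) * C₀ +
            (|a| * (Real.exp δN * Real.exp δN) + C₁) * Real.exp (-((δN - ρ₁) * gap)) * ((d + 1) * (CD / (L ^ k : ℕ))) +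
            ((|a| * (Real.exp δN * Real.exp δN) + C₁) * oψ + rN + oh * (|a| * (Real.exp δN * Real.exp δN) + C₁)) * Real.exp (-((δN - ρ₁) * gap)) * C)) *
          Real.exp (-(ρ * tdistT M y y')))) := by
  have hcN : 0 ≤ |a| * (Real.exp δN * Real.exp δN) + C₁ := by positivity
  -- the fine sandwich letter (N-IIt §2), output localization dropped
  have hT' : HasMaj (BlockNorm.ofBlocks (unitTorusGeo L k M) (fun b : Tor (fine (L ^ r * L ^ k) M) × Fin (d + 1) => blockOf (L ^ r * L ^ k) M b.1))
      (BlockNorm.ofBlocks (unitTorusGeo L k M) (fun b : Tor (fine (L ^ r * L ^ k) M) × Fin (d + 1) => blockOf (L ^ r * L ^ k) M b.1))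
      (mulOp h' ∘ₗ (a • (qvAdjRe M (L ^ r * L ^ k) ∘ₗ qvRe M (L ^ r * L ^ k)) + (-landauRe M (L ^ r * L ^ k))) ∘ₗ mulOp ψ')
      (fun y y' => (|a| * (Real.exp δN * Real.exp δN) + C₁) * Real.exp (-((δN - ρ₁) * gap)) * Real.exp (-(ρ₁ * tdistT M y y'))) := by
    refine (hasMaj_tailSandwich (L := L) (k := k) (a := a) hC₁ hδN hδN₁ hρ₁ hNL' hh1' hhH' hψ1' hψA' hgap).mono fun y y' => ?_
    have hX : 0 ≤ (|a| * (Real.exp δN * Real.exp δN) + C₁) * Real.exp (-((δN - ρ₁) * gap)) * Real.exp (-(ρ₁ * tdistT M y y')) := by positivity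
    calc ind H y * ((|a| * (Real.exp δN * Real.exp δN) + C₁) * Real.exp (-((δN - ρ₁) * gap)) * Real.exp (-(ρ₁ * tdistT M y y')))
        ≤ 1 * ((|a| * (Real.exp δN * Real.exp δN) + C₁) * Real.exp (-((δN - ρ₁) * gap)) * Real.exp (-(ρ₁ * tdistT M y y'))) :=
          mul_le_mul_of_nonneg_right (ind_le_one _ _) hX
      _ = _ := one_mul _
  -- the sandwich's defect letter (§1)
  have hDT := hasMaj_idef_tailSandwich (L := L) (k := k) (r := r) (a := a) hC₁ hδN hδN₁ hρ₁ hrN hoh hoψ hNL hNL' hDN hhH hψ1 hψA hh1' hhH' hψA' hfh hfψ hgap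
  have ha₁ : 0 ≤ (|a| * (Real.exp δN * Real.exp δN) + C₁) * Real.exp (-((δN - ρ₁) * gap)) := by positivity
  have hr₁ : 0 ≤ ((|a| * (Real.exp δN * Real.exp δN) + C₁) * oψ + rN + oh * (|a| * (Real.exp δN * Real.exp δN) + C₁)) * Real.exp (-((δN - ρ₁) * gap)) := by positivity
  have key := hasMaj_idef_chiCube_comp_neumannCubeG_of (r := r) (c := c) (S := S) hM ha htri hrow hC hC₀ hCD hδ₀ ha₁ hr₁ hρ hρδ hρσ hG h0 h1 hT' hDT
  -- remove the cube's cut behind the partition functions, move the sign out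
  have hcut := mulOp_chiCube_comp_mulOp (n := L ^ k) (c := c) (S := S) hhH hHc
  have hcut' := mulOp_chiCube_comp_mulOp (n := L ^ r * L ^ k) (c := c) (S := S) hhH' hHc
  have e := idef_neg_cutTail_eq (kingPrV L k r M) ((a • (qvAdjRe M (L ^ k) ∘ₗ qvRe M (L ^ k)) + (-landauRe M (L ^ k))) ∘ₗ mulOp ψ) (neumannCubeG M (L ^ k) c S a)
    ((a • (qvAdjRe M (L ^ r * L ^ k) ∘ₗ qvRe M (L ^ r * L ^ k)) + (-landauRe M (L ^ r * L ^ k))) ∘ₗ mulOp ψ') (neumannCubeG M (L ^ r * L ^ k) c S a) hcut hcut'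
  exact (key.neg.mono fun y y' => le_of_eq (by ring)).congr fun μ => (LinearMap.congr_fun e μ).symm

end Cube

/-! ## §3 Every analytic letter discharged on the lineage's doubled tori -/

section Family

variable {L : ℕ} [NeZero L]

omit [NeZero L] in
/-- bookkeeping: `1∕L^k ≤ (L^k)^{−γ∕2}` for `L^k ≥ 1`, `γ ≤ 2`. [folklore] -/
theorem inv_natPow_le_rpow {k : ℕ} {γ : ℝ} (hn1 : (1 : ℝ) ≤ ((L ^ k : ℕ) : ℝ)) (hγ : γ / 2 ≤ 1) :
    1 / ((L ^ k : ℕ) : ℝ) ≤ ((L ^ k : ℕ) : ℝ) ^ (-(γ / 2)) := by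
  rw [one_div, ← Real.rpow_neg_one]
  exact Real.rpow_le_rpow_of_exponent_le hn1 (by linarith)

/-- ★★★ **THE η-DEFECT OF THE TAIL ROWS OF THE LINEAGE's NEUMANN CUBES, HYPOTHESIS-FREE IN EVERY ANALYTIC LETTER** (dag-n15-w3 file 45 `hDT`): for odd `L ≥ 3`, `a > 0`, `0 < γ < 1`
there are `δ_T, δ_g, c_T > 0` such that on EVERY doubled torus `M_ν = 2L^{m_T} = 2S` of the family (cube side `S` in any spelling), for EVERY `k ≥ 1`, `r`, corner `c`, EVERY pair of
partition functions `h, h′` (`|·| ≤ 1`, on blocks `H ⊆ □`), collars `ψ, ψ′` (`|·| ≤ 1`, vanishing on the plateau blocks `A`), fits `|h′ − h∘π| ≤ o_h`, `|ψ′ − ψ∘π| ≤ o_ψ` (`o_h, o_ψ ≥ 0`)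
and `|y − y′|_T ≥ gap` for `y ∈ H`, `y′ ∉ A`:
`𝔇((−M_{h′}N′_LM_{ψ′})∘G′(□ + c), (−M_hN_LM_ψ)∘G(□ + c)) ≤ 1_□(y)1_□(y′)·c_T·(o_h + o_ψ + (L^k)^{−γ∕2})·e^{−δ_g·gap}·e^{−δ_T|y−y′|_T}` — exponentially small in the margin, linear in the fits,
King's rate for the rest.  Letters: `hasMaj_gOp`, `hasMaj_entries110`, `hasMaj_twoGridDefect` ([B5] Prop. 1.2 (1.110) at `U ≡ 1` + King's rate), `hasMaj_landauRe` ((1.126)), dag-n15-c FILE 99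
`hasMaj_idef_nonlocal_family`, (2.61) row sums.
[cite: Balaban1985BackgroundPropagators, Thm 3.14 pp.426–427 (difference template), (3.63)–(3.65) pp.402–403 (mechanism); Balaban1984PropagatorsII, (2.36)–(2.37) p.229, Lemma 2.1 (2.61) p.234, (2.92)–(2.93) p.239, (2.133)–(2.134) p.247; Balaban1984PropagatorsI, (1.69) p.29, Prop. 1.2 (1.110) p.35, (1.120)–(1.123) p.37, (1.126) p.38; King1986, Prop. 3.8 (3.71) p.664, Prop. 3.9 (3.73) p.665 (η-rate shape)] -/
theorem hasMaj_idef_tail_neumannCubeG (hLodd : Odd L) (hL2 : 2 ≤ L) {a : ℝ} (ha : 0 < a) {γ : ℝ} (hγ0 : 0 < γ) (hγ1 : γ < 1) :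
    ∃ δT δg cT : ℝ, 0 < δT ∧ 0 < δg ∧ 0 < cT ∧ ∀ (mT k r : ℕ) (hk : 1 ≤ k) (hL : Odd L ∧ 1 < L) (S : ℕ) (hS : ∀ ν, MP (paramsOf d L mT k hL) ν = 2 * S)
      (c : Tor (MP (paramsOf d L mT k hL))) (H A : Set (Tor (MP (paramsOf d L mT k hL)))) (gap oh oψ : ℝ), 0 ≤ oh → 0 ≤ oψ →
      (∀ y, y ∈ H → y ∈ cubeBlocks (MP (paramsOf d L mT k hL)) c S) →
      (∀ y y', y ∈ H → y' ∉ A → gap ≤ tdistT (MP (paramsOf d L mT k hL)) y y') →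
      ∀ (h ψ : Tor (fine (L ^ k) (MP (paramsOf d L mT k hL))) × Fin (d + 1) → ℝ) (h' ψ' : Tor (fine (L ^ r * L ^ k) (MP (paramsOf d L mT k hL))) × Fin (d + 1) → ℝ),
        (∀ x, blockOf (L ^ k) (MP (paramsOf d L mT k hL)) x.1 ∉ H → h x = 0) →
        (∀ x, |ψ x| ≤ 1) → (∀ x, blockOf (L ^ k) (MP (paramsOf d L mT k hL)) x.1 ∈ A → ψ x = 0) →
        (∀ x', |h' x'| ≤ 1) → (∀ x', blockOf (L ^ r * L ^ k) (MP (paramsOf d L mT k hL)) x'.1 ∉ H → h' x' = 0) →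
        (∀ x', |ψ' x'| ≤ 1) → (∀ x', blockOf (L ^ r * L ^ k) (MP (paramsOf d L mT k hL)) x'.1 ∈ A → ψ' x' = 0) →
        (∀ x', |h' x' - h (kingPrV L k r (MP (paramsOf d L mT k hL)) x')| ≤ oh) → (∀ x', |ψ' x' - ψ (kingPrV L k r (MP (paramsOf d L mT k hL)) x')| ≤ oψ) →
        HasMaj (BlockNorm.ofBlocks (unitTorusGeo L k (MP (paramsOf d L mT k hL))) (blkFine L k (MP (paramsOf d L mT k hL))))
          (BlockNorm.ofBlocks (unitTorusGeo L k (MP (paramsOf d L mT k hL)))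
            (fun i : Tor (fine (L ^ r * L ^ k) (MP (paramsOf d L mT k hL))) × Fin (d + 1) => blockOf (L ^ r * L ^ k) (MP (paramsOf d L mT k hL)) i.1))
          (idef (pull (kingPrV L k r (MP (paramsOf d L mT k hL)))) (pull (kingPrV L k r (MP (paramsOf d L mT k hL))))
            ((-(mulOp h' ∘ₗ (a • (qvAdjRe (MP (paramsOf d L mT k hL)) (L ^ r * L ^ k) ∘ₗ qvRe (MP (paramsOf d L mT k hL)) (L ^ r * L ^ k)) +
                (-landauRe (MP (paramsOf d L mT k hL)) (L ^ r * L ^ k))) ∘ₗ mulOp ψ')) ∘ₗ neumannCubeG (MP (paramsOf d L mT k hL)) (L ^ r * L ^ k) c S a)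
            ((-(mulOp h ∘ₗ (a • (qvAdjRe (MP (paramsOf d L mT k hL)) (L ^ k) ∘ₗ qvRe (MP (paramsOf d L mT k hL)) (L ^ k)) +
                (-landauRe (MP (paramsOf d L mT k hL)) (L ^ k))) ∘ₗ mulOp ψ)) ∘ₗ neumannCubeG (MP (paramsOf d L mT k hL)) (L ^ k) c S a))
          (fun y y' => ind ((cubeBlocks (MP (paramsOf d L mT k hL)) c S : Finset _) : Set _) y * ind ((cubeBlocks (MP (paramsOf d L mT k hL)) c S : Finset _) : Set _) y' *
            (cT * (oh + oψ + ((L ^ k : ℕ) : ℝ) ^ (-(γ / 2))) * Real.exp (-(δg * gap)) * Real.exp (-(δT * tdistT (MP (paramsOf d L mT k hL)) y y')))) := by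
  have hL : Odd L ∧ 1 < L := ⟨hLodd, by omega⟩
  obtain ⟨δG, CG, hδG, hCG, HG⟩ := hasMaj_gOp (d := d) hL ha
  obtain ⟨δD, CD, hδD, hCD, H0⟩ := hasMaj_twoGridDefect (d := d) hLodd hL2 ha hγ0 hγ1
  obtain ⟨δ₁, C₁, hδ₁, hC₁, H1⟩ := hasMaj_entries110 (d := d) hL ha
  obtain ⟨δΛ, CΛ, hδΛ, hCΛ, HΛ⟩ := hasMaj_landauRe (d := d) (L := L)
  obtain ⟨δND, rND, hδND, hrND, HND⟩ := hasMaj_idef_nonlocal_family (d := d) hLodd hL2 ha hγ0 hγ1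
  -- rates: `δ₀` for the torus data, `δ_N` for the nonlocal letters, `ρ₁ = δ_N∕2`, `σ = δ_N∕4`, `ρ = min δ₀ (δ_N∕4)`
  obtain ⟨δ₀, hδ₀def⟩ : ∃ δ₀ : ℝ, δ₀ = min δG (min δD δ₁) := ⟨_, rfl⟩
  have hδ₀ : 0 < δ₀ := by rw [hδ₀def]; exact lt_min hδG (lt_min hδD hδ₁)
  have hδ₀G : δ₀ ≤ δG := by rw [hδ₀def]; exact min_le_left _ _
  have hδ₀D : δ₀ ≤ δD := by rw [hδ₀def]; exact (min_le_right _ _).trans (min_le_left _ _)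
  have hδ₀₁ : δ₀ ≤ δ₁ := by rw [hδ₀def]; exact (min_le_right _ _).trans (min_le_right _ _)
  obtain ⟨δN, hδNdef⟩ : ∃ δN : ℝ, δN = min δΛ δND := ⟨_, rfl⟩
  have hδN : 0 < δN := by rw [hδNdef]; exact lt_min hδΛ hδND
  have hδNΛ : δN ≤ δΛ := by rw [hδNdef]; exact min_le_left _ _
  have hδNN : δN ≤ δND := by rw [hδNdef]; exact min_le_right _ _
  obtain ⟨ρ, hρdef⟩ : ∃ ρ : ℝ, ρ = min δ₀ (δN / 4) := ⟨_, rfl⟩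
  have hρ : 0 < ρ := by rw [hρdef]; exact lt_min hδ₀ (by positivity)
  have hρδ : ρ ≤ δ₀ := by rw [hρdef]; exact min_le_left _ _
  have hρN : ρ ≤ δN / 4 := by rw [hρdef]; exact min_le_right _ _
  obtain ⟨cr, hcrdef⟩ : ∃ cr : ℝ, cr = B4Sect5Proof.latticeConst (d + 1) (δN / 4) := ⟨_, rfl⟩
  have hcr : 0 ≤ cr := by
    have h := (rowSum_unitTorusGeo L 0 (MP (paramsOf d L 0 0 hL)) (by positivity : 0 < δN / 4)).nonneg (fun _ => 0)
    rw [hcrdef]; exact h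
  obtain ⟨cN, hcNdef⟩ : ∃ cN : ℝ, cN = |a| * (Real.exp δN * Real.exp δN) + CΛ := ⟨_, rfl⟩
  have hcN : 0 ≤ cN := by rw [hcNdef]; positivity
  obtain ⟨cT, hcTdef⟩ : ∃ cT : ℝ, cT = 2 ^ (d + 1) * Real.exp δ₀ * cr * (cN * CD + cN * ((d + 1) * C₁) + cN * CG + rND * CG) + 1 := ⟨_, rfl⟩
  have hcT : 0 < cT := by rw [hcTdef]; positivity
  refine ⟨ρ, δN / 2, cT, hρ, by positivity, hcT, fun mT k r hk hL' S hS c H A gap oh oψ hoh hoψ hHc hgap h ψ h' ψ' hhH hψ1 hψA hh1' hhH' hψ1' hψA' hfh hfψ => ?_⟩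
  have hn1 : 1 ≤ L ^ k := Nat.one_le_pow _ _ (by omega)
  have hnr1 : (1 : ℝ) ≤ ((L ^ k : ℕ) : ℝ) := by exact_mod_cast hn1
  have hnr0 : (0 : ℝ) < ((L ^ k : ℕ) : ℝ) := by linarith
  haveI : NeZero (L ^ r * L ^ k) := ⟨Nat.mul_ne_zero (pow_ne_zero r (NeZero.ne L)) (pow_ne_zero k (NeZero.ne L))⟩
  obtain ⟨ρk, hρkdef⟩ : ∃ ρk : ℝ, ρk = ((L ^ k : ℕ) : ℝ) ^ (-(γ / 2)) := ⟨_, rfl⟩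
  have hρk0 : 0 ≤ ρk := by rw [hρkdef]; exact Real.rpow_nonneg hnr0.le _
  have htri := triangle254_unitTorusGeo L k (MP (paramsOf d L mT k hL'))
  have hrow : RowSum (unitTorusGeo L k (MP (paramsOf d L mT k hL'))) (δN / 4) cr := by
    rw [hcrdef]; exact rowSum_unitTorusGeo L k (MP (paramsOf d L mT k hL')) (by positivity : 0 < δN / 4)
  -- the letters at this index, rates weakened to the common ones
  have hG := hasMaj_rate_mono hCG.le hδ₀G (HG mT k hk)
  have H0' := H0 mT k r hk hL'
  rw [← hρkdef] at H0'
  have h0 := hasMaj_rate_mono (mul_nonneg hCD.le hρk0) hδ₀D H0'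
  have h1 := fun ν => hasMaj_rate_mono hC₁.le hδ₀₁ (H1 mT k hk ν).1
  have hNL := HΛ k (L ^ k) (MP (paramsOf d L mT k hL'))
  have hNL' := HΛ k (L ^ r * L ^ k) (MP (paramsOf d L mT k hL'))
  have HND' := HND mT k r hk hL'
  rw [← hρkdef] at HND'
  have hDN := hasMaj_rate_mono (mul_nonneg hrND.le hρk0) hδNN HND'
  have hmain := hasMaj_idef_tail_neumannCubeG_of (L := L) (k := k) (r := r) (c := c) (S := S) hS ha htri hrow hCG.le (mul_nonneg hCD.le hρk0) hC₁.le hδ₀.le hCΛ.le hδN.le hδNΛ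
    (mul_nonneg hrND.le hρk0) (by linarith : δN / 2 ≤ δN) hρ.le hρδ (by linarith : ρ + δN / 4 ≤ δN / 2) hoh hoψ hG h0 h1 hNL hNL' hDN
    hhH hHc hψ1 hψA hh1' hhH' hψ1' hψA' hfh hfψ hgap
  refine hmain.mono fun y y' => ?_
  have hI : 0 ≤ ind (g := unitTorusGeo L k (MP (paramsOf d L mT k hL'))) ((cubeBlocks (MP (paramsOf d L mT k hL')) c S : Finset _) : Set _) y *
      ind (g := unitTorusGeo L k (MP (paramsOf d L mT k hL'))) ((cubeBlocks (MP (paramsOf d L mT k hL')) c S : Finset _) : Set _) y' :=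
    mul_nonneg (ind_nonneg _ _) (ind_nonneg _ _)
  refine mul_le_mul_of_nonneg_left (mul_le_mul_of_nonneg_right ?_ (Real.exp_nonneg _)) hI
  -- bookkeeping: the gap factor is common, `1∕L^k ≤ (L^k)^{−γ∕2}`, the fits and the rate collect into `(o_h + o_ψ + ρ_k)`
  have hgap' : δN - δN / 2 = δN / 2 := by ring
  rw [hgap', ← hcNdef]
  obtain ⟨Eg, hEgdef⟩ : ∃ Eg : ℝ, Eg = Real.exp (-(δN / 2 * gap)) := ⟨_, rfl⟩
  rw [← hEgdef]
  have hEg : 0 ≤ Eg := by rw [hEgdef]; exact Real.exp_nonneg _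
  have hinv : 1 / ((L ^ k : ℕ) : ℝ) ≤ ρk := by rw [hρkdef]; exact inv_natPow_le_rpow (L := L) hnr1 (by linarith)
  have t2 : (d + 1) * (C₁ / ((L ^ k : ℕ) : ℝ)) ≤ (d + 1) * C₁ * ρk := by
    rw [div_eq_mul_one_div, ← mul_assoc]; exact mul_le_mul_of_nonneg_left hinv (by positivity)
  -- the bracket
  have hB : 0 ≤ oh + oψ + ρk := by positivity
  have hρkB : ρk ≤ oh + oψ + ρk := by linarith
  have hoψB : oψ ≤ oh + oψ + ρk := by linarith
  have hohB : oh ≤ oh + oψ + ρk := by linarith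
  have e1 : cN * Eg * (CD * ρk) ≤ Eg * (cN * CD) * (oh + oψ + ρk) :=
    calc cN * Eg * (CD * ρk) = Eg * (cN * CD) * ρk := by ring
      _ ≤ Eg * (cN * CD) * (oh + oψ + ρk) := mul_le_mul_of_nonneg_left hρkB (by positivity)
  have e2 : cN * Eg * ((d + 1) * (C₁ / ((L ^ k : ℕ) : ℝ))) ≤ Eg * (cN * ((d + 1) * C₁)) * (oh + oψ + ρk) :=
    calc cN * Eg * ((d + 1) * (C₁ / ((L ^ k : ℕ) : ℝ))) ≤ cN * Eg * ((d + 1) * C₁ * ρk) := mul_le_mul_of_nonneg_left t2 (mul_nonneg hcN hEg)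
      _ = Eg * (cN * ((d + 1) * C₁)) * ρk := by ring
      _ ≤ Eg * (cN * ((d + 1) * C₁)) * (oh + oψ + ρk) := mul_le_mul_of_nonneg_left hρkB (by positivity)
  have e3 : (cN * oψ + rND * ρk + oh * cN) * Eg * CG ≤ Eg * (cN * CG + rND * CG) * (oh + oψ + ρk) := by
    have f1 : Eg * (cN * CG) * oψ + Eg * (cN * CG) * oh ≤ Eg * (cN * CG) * (oh + oψ + ρk) := by
      rw [← mul_add]; exact mul_le_mul_of_nonneg_left (by linarith) (by positivity)
    have f2 : Eg * (rND * CG) * ρk ≤ Eg * (rND * CG) * (oh + oψ + ρk) := mul_le_mul_of_nonneg_left hρkB (by positivity)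
    calc (cN * oψ + rND * ρk + oh * cN) * Eg * CG = (Eg * (cN * CG) * oψ + Eg * (cN * CG) * oh) + Eg * (rND * CG) * ρk := by ring
      _ ≤ Eg * (cN * CG) * (oh + oψ + ρk) + Eg * (rND * CG) * (oh + oψ + ρk) := add_le_add f1 f2
      _ = Eg * (cN * CG + rND * CG) * (oh + oψ + ρk) := by ring
  have hbr : cN * Eg * (CD * ρk) + cN * Eg * ((d + 1) * (C₁ / ((L ^ k : ℕ) : ℝ))) + (cN * oψ + rND * ρk + oh * cN) * Eg * CG ≤
      Eg * ((cN * CD + cN * ((d + 1) * C₁) + cN * CG + rND * CG) * (oh + oψ + ρk)) :=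
    calc cN * Eg * (CD * ρk) + cN * Eg * ((d + 1) * (C₁ / ((L ^ k : ℕ) : ℝ))) + (cN * oψ + rND * ρk + oh * cN) * Eg * CG
        ≤ Eg * (cN * CD) * (oh + oψ + ρk) + Eg * (cN * ((d + 1) * C₁)) * (oh + oψ + ρk) + Eg * (cN * CG + rND * CG) * (oh + oψ + ρk) :=
          add_le_add (add_le_add e1 e2) e3
      _ = Eg * ((cN * CD + cN * ((d + 1) * C₁) + cN * CG + rND * CG) * (oh + oψ + ρk)) := by ring
  have hpre : 0 ≤ 2 ^ (d + 1) * Real.exp δ₀ * cr := by positivity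
  calc 2 ^ (d + 1) * Real.exp δ₀ * cr * (cN * Eg * (CD * ρk) + cN * Eg * ((d + 1) * (C₁ / ((L ^ k : ℕ) : ℝ))) + (cN * oψ + rND * ρk + oh * cN) * Eg * CG)
      ≤ 2 ^ (d + 1) * Real.exp δ₀ * cr * (Eg * ((cN * CD + cN * ((d + 1) * C₁) + cN * CG + rND * CG) * (oh + oψ + ρk))) := mul_le_mul_of_nonneg_left hbr hpre
    _ = (2 ^ (d + 1) * Real.exp δ₀ * cr * (cN * CD + cN * ((d + 1) * C₁) + cN * CG + rND * CG)) * (oh + oψ + ρk) * Eg := by ring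
    _ ≤ cT * (oh + oψ + ρk) * Eg := by
        refine mul_le_mul_of_nonneg_right (mul_le_mul_of_nonneg_right ?_ hB) hEg
        rw [hcTdef]; linarith
    _ = cT * (oh + oψ + ((L ^ k : ℕ) : ℝ) ^ (-(γ / 2))) * Eg := by rw [hρkdef]

end Family

end Summit.QuantumFields.YangMills.BalabanUVNodes.N15.TwoGrid

end
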